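import Summits.HubbardSuperconductivity.HubbardSuperconductivity.Theorems.AnisotropyChordTransferFibre3FinX3Eval

/-!
# Route `AnisotropyChord` / H0 rotor rung: FIN per-`L` GM₃ (X5), `L = 34` — rows `N₁` / D / side-condition cell facts, part `p28`

Kernel facts (`decide +kernel`) for cert cells 76, 77 of the per-`L` grid of `L = 34`: `xbnCellAny2` (row `N₁` on XB2 point wedges recomputed in the kernel, exporting the literal brackets `nt ⊇ T⁺ − 3λ₂` and `tb ⊇ T⁺·D`), `xdCellAnyN0` (row D, reads `nt`), `sdCellAnyZN` (side condition, reads `nt`); evaluators `…FinX3Eval` / `…FinX5Eval`; constants from the compiled design probe (x3probe/x3plan, margins c ×0.985, b ×1.03, aD ×1.03); assembled in `…FinX5GM3ThirtyFour`.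
Prover seat `hubbard-h0-rotor-p3` g8; helper for piece A = stmt-HubbardSuperconductivity-23918 of rung 19089 (`--supports`, helper class).
WHAT THIS IS NOT: nothing here proves superconductivity in the Hubbard model (rotor TARGET as worded stays FALSE, g15 verdict); kernel facts for the FIN certificate of ONE conditional reduction.  Tree imports only; zero data; standard axioms.
-/

set_option linter.dupNamespace false
set_option autoImplicit false

namespace Summit.HubbardSuperconductivity.HubbardSuperconductivity.Theorems.AnisotropyChord.Transfer.Fibre3

namespace FinXD

open FinXB FinCell Hole2

set_option maxHeartbeats 4000000 in
/-- row `N₁` of cell 76 of `L = 34` (`c = 61/100`), exporting `nt`, `tb`. [folklore] -/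
theorem xn34_76 : xbnCellAny2 34 (49/50 : ℚ) 294584757251978 301949376183278 (61/100 : ℚ) ((-480498465408 : ℤ), (1759944012066 : ℤ)) ((883268379282520 : ℤ), (907613466569906 : ℤ)) = true := by decide +kernel

set_option maxHeartbeats 4000000 in
/-- row D of cell 76 of `L = 34` (`aD = 17/200`). [folklore] -/
theorem xd34_76 : xdCellAnyN0 34 (49/50 : ℚ) 294584757251978 301949376183278 (17/200 : ℚ) ((-480498465408 : ℤ), (1759944012066 : ℤ)) = true := by decide +kernel

set_option maxHeartbeats 4000000 in
/-- side condition of cell 76 of `L = 34` (`c, b = 63/100, aD`). [folklore] -/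
theorem sd34_76 : sdCellAnyZN 34 (49/50 : ℚ) 100 294584757251978 301949376183278 ((61/100 : ℚ), (63 : ℕ), (17/200 : ℚ)) ((-480498465408 : ℤ), (1759944012066 : ℤ)) = true := by decide +kernel

set_option maxHeartbeats 4000000 in
/-- row `N₁` of cell 77 of `L = 34` (`c = 61/100`), exporting `nt`, `tb`. [folklore] -/
theorem xn34_77 : xbnCellAny2 34 (49/50 : ℚ) 301949376183278 309498110587860 (61/100 : ℚ) ((-432605365874 : ℤ), (1804709012003 : ℤ)) ((905409994325754 : ℤ), (930304569633789 : ℤ)) = true := by decide +kernel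

set_option maxHeartbeats 4000000 in
/-- row D of cell 77 of `L = 34` (`aD = 21/250`). [folklore] -/
theorem xd34_77 : xdCellAnyN0 34 (49/50 : ℚ) 301949376183278 309498110587860 (21/250 : ℚ) ((-432605365874 : ℤ), (1804709012003 : ℤ)) = true := by decide +kernel

set_option maxHeartbeats 4000000 in
/-- side condition of cell 77 of `L = 34` (`c, b = 63/100, aD`). [folklore] -/
theorem sd34_77 : sdCellAnyZN 34 (49/50 : ℚ) 100 301949376183278 309498110587860 ((61/100 : ℚ), (63 : ℕ), (21/250 : ℚ)) ((-432605365874 : ℤ), (1804709012003 : ℤ)) = true := by decide +kernel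

end FinXD

end Summit.HubbardSuperconductivity.HubbardSuperconductivity.Theorems.AnisotropyChord.Transfer.Fibre3
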